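import Mathlib.RingTheory.Invariant.Basic
import Mathlib.RingTheory.FiniteType
import Mathlib.RingTheory.Adjoin.Tower
import Mathlib.FieldTheory.Fixed
import HarnessLib

/-!
# The fixed model of a finite group: finite generation (E. Noether) and fraction field ([CoP1] Lemma 9.4, "`R₁ := S₁^G` is a normal local model of `V/k`")

Topic: `Literature/AlgebraicGeometry/Resolution`. PROOF side of `CossartPiltant2019ReductionP`
(`ArithmeticalThreefoldsLocal.lean`), input (C4). In [CoP1] (Cossart–Piltant, J. Algebra 320
(2008)) the local uniformization downstairs in both descent steps (Lemma 9.4, tame layer; proof of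
Prop. 9.3, inertia layer) is the ring of invariants of a stable model upstairs: "`S̄ := S[y₁, y₂,
y₃]` … Let `R₁ := S₁^G`. Then `R₁` is a normal local MODEL of `V/k`" (HAL p. 29) — i.e. the
invariants `S̄^G` of the finitely generated `S`-algebra `S̄` are again finitely generated over `S`
(E. Noether's finiteness theorem, Atiyah–Macdonald Ch. 7 Ex. 5) with fraction field the fixed
field `Frac(S̄)^G = V` (an invariant fraction `y/z` is `y ∏_{g≠1} g•z / ∏_g g•z`). The tree has
the cyclic case (`CyclicInvariantsFiniteType.lean`, `InvariantFractionField.lean`); this file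
gives the finite-group case in the currency of subrings `Subring.closure (φ(S) ∪ t)` of a field
`F` carrying the group action (`[MulSemiringAction G F]`), as used by the inertia layer
(`ArithmeticalThreefoldsLocalDescentInertiaStable.lean`):

* `smul_mem_closure_of_stable` — PROVED: `S[t]` is `G`-stable when `G` fixes `φ(S)` and
  permutes `t`;
* `mem_subfieldClosure_inf_fixedPoints_of_smul_eq` — PROVED: `Frac(B)^G ⊆ Frac(B^G)` for a
  `G`-stable subring `B` (norm of the denominator);
* `exists_finset_closure_eq_inf_fixedPoints` — PROVED (E. Noether): for `S` Noetherian there is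
  a finite `t₁ ⊆ F^G` with `S[t₁] = S[t] ∩ F^G` (Artin–Tate, Mathlib `fg_of_fg_of_fg`, applied to
  `S ⊆ S[t]^G ⊆ S[t]`, the last step integral by Mathlib `Algebra.IsInvariant.isIntegral`).

Everything is PROVED; no named facts, definitions, instances or notation are introduced.

## Sources

* V. Cossart, O. Piltant, J. Algebra 320 (2008) 1051–1082: proof of Lemma 9.4 (HAL
  hal-00139124, p. 29) and of Prop. 9.3 (p. 27). [CossartPiltant2008]
* M. F. Atiyah, I. G. Macdonald, *Introduction to Commutative Algebra* (1969), Ch. 7 Ex. 5,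
  Prop. 7.8, Ch. 5 Ex. 12. [AtiyahMacdonald1969]
-/

noncomputable section

namespace Literature.AlgebraicGeometry.Resolution

universe u v

section FixedModelFiniteness

variable {S : Type u} [CommRing S] {F : Type u} [Field F]
  {G : Type v} [Group G] [Fintype G] [MulSemiringAction G F]

omit [Fintype G] in
/-- `S[t] = closure(φ(S) ∪ t)` is `G`-stable when `G` fixes `φ(S)` pointwise and maps `t` into
itself ("`S̄ := S[y₁, y₂, y₃]` … is stable by `G`"). [cite: CossartPiltant2008, proof of Lemma 9.4 (HAL p. 29)] -/
theorem smul_mem_closure_of_stable (φ : S →+* F) (hφ : ∀ (g : G) (s : S), g • φ s = φ s)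
    {t : Set F} (ht : ∀ (g : G), ∀ x ∈ t, g • x ∈ t) (g : G) {x : F}
    (hx : x ∈ Subring.closure (Set.range φ ∪ t)) :
    g • x ∈ Subring.closure (Set.range φ ∪ t) := by
  have hle : Subring.closure (Set.range φ ∪ t) ≤
      (Subring.closure (Set.range φ ∪ t)).comap
        (MulSemiringAction.toRingHom G F g) := by
    refine Subring.closure_le.mpr ?_
    rintro y (⟨s, rfl⟩ | hy)
    · refine Subring.mem_comap.mpr ?_
      rw [MulSemiringAction.toRingHom_apply, hφ]
      exact Subring.subset_closure (Or.inl ⟨s, rfl⟩)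
    · refine Subring.mem_comap.mpr ?_
      rw [MulSemiringAction.toRingHom_apply]
      exact Subring.subset_closure (Or.inr (ht g y hy))
  exact Subring.mem_comap.mp (hle hx)

/-- **`Frac(B)^G ⊆ Frac(B^G)`**: an invariant fraction `y/z` of elements of a `G`-stable subring
`B` is a fraction of invariant elements of `B`, namely `(y ∏_{g≠1} g•z) / ∏_g g•z` ("`R₁ := S₁^G`
… is a normal local model of `V/k`": its fraction field is `V = W^G`).
[cite: CossartPiltant2008, proof of Lemma 9.4 (HAL p. 29)] -/
theorem mem_subfieldClosure_inf_fixedPoints_of_smul_eq {B : Subring F}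
    (hB : ∀ (g : G), ∀ x ∈ B, g • x ∈ B) {x : F} (hx : x ∈ Subfield.closure (B : Set F))
    (hxG : ∀ g : G, g • x = x) :
    x ∈ Subfield.closure ((B ⊓ FixedPoints.subring F G : Subring F) : Set F) := by
  classical
  have hmem : ∀ x : F, x ∈ FixedPoints.subring F G ↔ ∀ g : G, g • x = x := fun x => Iff.rfl
  obtain ⟨y, hy, z, hz, rfl⟩ := Subfield.mem_closure_iff.mp hx
  rw [Subring.closure_eq] at hy hz
  rw [Subfield.mem_closure_iff, Subring.closure_eq]
  by_cases hz0 : z = 0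
  · exact ⟨0, Subring.zero_mem _, 1, Subring.one_mem _, by rw [hz0, div_zero, zero_div]⟩
  -- the norm of the denominator
  set z' : F := ∏ g : G, g • z with hz'def
  have hz'B : z' ∈ B := Subring.prod_mem _ fun g _ => hB g z hz
  have hz'G : ∀ h : G, h • z' = z' := fun h => by
    rw [hz'def, Finset.smul_prod', ← Equiv.prod_comp (Equiv.mulLeft h⁻¹)]
    refine Finset.prod_congr rfl fun g _ => ?_
    rw [Equiv.coe_mulLeft, smul_smul, mul_inv_cancel_left]
  have hz'0 : z' ≠ 0 := by
    rw [hz'def]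
    refine Finset.prod_ne_zero_iff.mpr fun g _ hgz => hz0 ?_
    simpa using congrArg (fun x => g⁻¹ • x) hgz
  set z'' : F := ∏ g ∈ Finset.univ.erase (1 : G), g • z with hz''def
  have hz'eq : z' = z * z'' := by
    rw [hz'def, hz''def, ← Finset.mul_prod_erase Finset.univ (fun g : G => g • z)
      (Finset.mem_univ 1), one_smul]
  have hz''B : z'' ∈ B := Subring.prod_mem _ fun g _ => hB g z hz
  set y' : F := y / z * z' with hy'def
  have hy'eq : y' = y * z'' := by rw [hy'def, hz'eq]; field_simp
  have hy'B : y' ∈ B := by rw [hy'eq]; exact B.mul_mem hy hz''B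
  have hy'G : ∀ h : G, h • y' = y' := fun h => by rw [hy'def, smul_mul', hxG h, hz'G h]
  refine ⟨y', ⟨hy'B, (hmem y').mpr hy'G⟩, z', ⟨hz'B, (hmem z').mpr hz'G⟩, ?_⟩
  rw [hy'def, mul_div_assoc, div_self hz'0, mul_one]

/-- **E. Noether's finiteness for the fixed model**: for `S` Noetherian, `φ : S → F`, a finite
group `G` of automorphisms of `F` fixing `φ(S)` and permuting the finite set `t`, there is a
finite set `t₁` of invariants with `S[t₁] = S[t] ∩ F^G` — the ring of invariants of the model
`S[t]` is again a model ("`R₁ := S₁^G` … is a normal local MODEL of `V/k`"). Proof: `S[t]` is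
integral (Mathlib `Algebra.IsInvariant.isIntegral`) and of finite type, hence finite, over
`S[t]^G`, so `S[t]^G` is of finite type over `S` by Artin–Tate (Mathlib `fg_of_fg_of_fg`).
[cite: CossartPiltant2008, proof of Lemma 9.4 (HAL p. 29); AtiyahMacdonald1969, Ch. 7 Ex. 5] -/
theorem exists_finset_closure_eq_inf_fixedPoints [IsNoetherianRing S] (φ : S →+* F)
    (hφ : ∀ (g : G) (s : S), g • φ s = φ s) (t : Finset F)
    (ht : ∀ (g : G), ∀ x ∈ t, g • x ∈ t) :
    ∃ t₁ : Finset F, (∀ x ∈ t₁, ∀ g : G, g • x = x) ∧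
      Subring.closure (Set.range φ ∪ (t₁ : Set F)) =
        Subring.closure (Set.range φ ∪ (t : Set F)) ⊓ FixedPoints.subring F G := by
  classical
  have hmem : ∀ x : F, x ∈ FixedPoints.subring F G ↔ ∀ g : G, g • x = x := fun x => Iff.rfl
  letI : Algebra S F := φ.toAlgebra
  have hφ' : ∀ s : S, algebraMap S F s = φ s := fun _ => rfl
  haveI : SMulCommClass G S F := ⟨fun g s x => by
    rw [Algebra.smul_def, Algebra.smul_def, smul_mul', hφ', hφ]⟩
  set B₀ : Subalgebra S F := Algebra.adjoin S (t : Set F) with hB₀def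
  have hB₀cl : B₀.toSubring = Subring.closure (Set.range φ ∪ (t : Set F)) :=
    Algebra.adjoin_eq_ring_closure _
  have hB₀st : ∀ (g : G), ∀ x ∈ B₀, g • x ∈ B₀ := by
    intro g x hx
    have h : g • x ∈ Subring.closure (Set.range φ ∪ (t : Set F)) :=
      smul_mem_closure_of_stable φ hφ (fun g x hx => ht g x hx) g (hB₀cl ▸ hx)
    rwa [← hB₀cl] at h
  let A₀ : Subalgebra S F := B₀ ⊓ FixedPoints.subalgebra S F G
  have hA₀mem : ∀ x : F, x ∈ A₀ ↔ x ∈ B₀ ∧ ∀ g : G, g • x = x := fun x => Iff.rfl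
  -- the tower `S → A₀ → B₀`
  letI alg : Algebra A₀ B₀ := (Subalgebra.inclusion (inf_le_left : A₀ ≤ B₀)).toAlgebra
  haveI : IsScalarTower S A₀ B₀ := IsScalarTower.of_algebraMap_eq fun _ => rfl
  letI actB : MulSemiringAction G B₀ :=
    { smul := fun g x => ⟨g • (x : F), hB₀st g x x.2⟩
      one_smul := fun x => Subtype.ext (one_smul G (x : F))
      mul_smul := fun g h x => Subtype.ext (mul_smul g h (x : F))
      smul_zero := fun g => Subtype.ext (smul_zero g)
      smul_add := fun g x y => Subtype.ext (smul_add g (x : F) y)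
      smul_one := fun g => Subtype.ext (smul_one g)
      smul_mul := fun g x y => Subtype.ext (smul_mul' g (x : F) y) }
  have hsmul : ∀ (g : G) (x : B₀), ((g • x : B₀) : F) = g • (x : F) := fun _ _ => rfl
  haveI : Algebra.IsInvariant A₀ B₀ G := ⟨fun x hx =>
    ⟨⟨x, (hA₀mem _).mpr ⟨x.2, fun g => by rw [← hsmul]; exact congrArg Subtype.val (hx g)⟩⟩,
      rfl⟩⟩
  haveI : Algebra.IsIntegral A₀ B₀ := Algebra.IsInvariant.isIntegral A₀ B₀ G
  have hBfg : (⊤ : Subalgebra S B₀).FG := (Subalgebra.fg_top _).mpr (Subalgebra.fg_adjoin_finset t)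
  haveI : Algebra.FiniteType S B₀ := ⟨hBfg⟩
  haveI : Algebra.FiniteType A₀ B₀ := Algebra.FiniteType.of_restrictScalars_finiteType S A₀ B₀
  haveI : Module.Finite A₀ B₀ := Algebra.IsIntegral.finite
  have hA₀fg : (⊤ : Subalgebra S A₀).FG :=
    fg_of_fg_of_fg S A₀ B₀ hBfg Module.Finite.fg_top (Subalgebra.inclusion_injective _)
  obtain ⟨t₁, ht₁⟩ := (Subalgebra.fg_top _).mp hA₀fg
  refine ⟨t₁, fun x hx => ((hA₀mem x).mp (ht₁ ▸ Algebra.subset_adjoin hx)).2, ?_⟩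
  have h1 : (Algebra.adjoin S (t₁ : Set F)).toSubring =
      Subring.closure (Set.range φ ∪ (t₁ : Set F)) := Algebra.adjoin_eq_ring_closure _
  rw [← h1, ht₁, ← hB₀cl]
  ext x
  exact hA₀mem x

end FixedModelFiniteness

end Literature.AlgebraicGeometry.Resolution

end
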